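import Summits.BirchSwinnertonDyer.BirchSwinnertonDyer.Theorems.AlignedTransportAtTwoMainConjectureOfRankZeroBSDAtTwoCubicSplitStratumRelationDoor
import Literature.NumberTheory.IwasawaTheory.ClassGroupPRankLeOfRelationMatrixTwo
import HarnessLib

/-!
# Route `AlignedTransportAtTwo`, crux C2 `MainConjectureOfRankZeroBSDAtTwo` (stmt-BirchSwinnertonDyer-22298):
# THE TWO-GENERATOR RELATION DOOR for the cubic `2`-division field `ℚ(β)` — two classes `c₁, c₂ ∈ Cl(K_m)` with THREE genus certificates
# (`c₁`, `c₂`, `c₁c₂`) and a `2 × 2` RELATION MATRIX of determinant `(X−1)^d·u + 2·g`, `u(1)` odd, `d + 2 ≤ 2^m` ⟹ `rank₂ Cl(K_l) ≤ d ∀ l`, `μ₂ = 0`, `λ₂ ≤ d`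

HONEST FRAMING (cell `bsd-f1-sign2`, WIDTH-5 attached prover seat `bsd-line-att-p3` gen 54 on line `birth` of the lead `bsd-line-att-p2`; `--supports`
stmt-BirchSwinnertonDyer-22298, closes nothing; BSD is NOT proved by any of this; the crux C2, its verdict «blocked-on `Rank1Residual.GreenbergMuConjectureIrreducible`»
and every registered stub are untouched).  THEOREMS ONLY — no definition, no named fact, no `sorry`.

WHAT.  The `W`-level form of this seat's Literature theorem `IwasawaTheory.classicalMuVanishes_two_of_relation_matrix_of_three_genusCerts`
(`IwasawaTheory/ClassGroupPRankLeOfRelationMatrixTwo`, g54), itself the `p = 2` packaging of THE TWO-GENERATOR RELATION DOOR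
(`IwasawaTheory/ClassGroupPRankLeOfRelationMatrix` + the algebra brick `FukudaRelationMatrixAlgebra`: when the Iwasawa module needs TWO generators, `X = Λ²/N`, the
`p`-rank of every layer is bounded by the ORDER AT `X = 1` of the DETERMINANT of a `2 × 2` relation matrix — the length of `𝔽_p⟦T⟧²/(rows)` is the `T`-order of the
determinant).  Sister of att-p3 g53's ONE-generator split-stratum door `…CubicSplitStratumRelationDoor` (habitat: some dyadic bit of the fundamental unit is `1`,
`rank₂ Cl(ℚ(β,√2)) = 1`); THIS door's habitat is the complement on the split stratum: ALL three dyadic bits `0` (every unit `≡ ±1 (mod 𝔭³)` at every dyadic prime, so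
every dyadic prime carries genus certificates), `rank₂ Cl(ℚ(β,√2)) = 2` — att-p3 g53's census: the cubic field of discriminant `−1727` (seeds `1727a1`, `29359b1`,
`29359d1`), where no one-relation door can fire.  No stratum / ordinarity hypothesis is needed: a cubic field has at most three primes above `2`, and with `h` odd the
exact genus count gives `rank₂ Cl(K_1) ≤ 2` for free.

* **`classicalMuVanishes_adjoin_of_relation_matrix_of_three_genusCerts`** — `W/ℚ` with no rational `2`-torsion abscissa, `Δ_W < 0` (unit rank one), `β` a root of the
  `2`-division cubic, `K = ℚ(β)`; displayed data of `K`: `h_K` odd, `2 ∤ d_K`; a unit `ε` with `±ε` non-squares (e.g. the fundamental unit); THREE ideals `𝔭_a, 𝔭_b, 𝔭_c`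
  of norm `2` (not necessarily distinct) with `ε ≡ ±1 (mod 𝔭_j³)` (so EVERY unit is `≡ ±1 (mod 𝔭_j³)`); `κ` a cyclotomic `ℤ₂`-extension of `K`, a layer `m ≥ 1` with any
  compatible algebra structure `K_1 → K_m`; two classes `c₁, c₂ ∈ Cl(K_m)` with GENUS CERTIFICATES `(𝔄_a, k_a, π_a)` for `c₁` at `𝔭_a`, `(𝔄_b, k_b, π_b)` for `c₂` at `𝔭_b`,
  `(𝔄_c, k_c, π_c)` for `c₁c₂` at `𝔭_c` (`N_{K_m/K_1}(c) = [𝔄]`, `N_{K_1/K}(𝔄)^k = (π)`, `π ≡ ±3 (mod 𝔭³)`); `σ` a generator of `Gal(K_m/K)`; a `2 × 2` RELATION MATRIX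
  `∏_{i<N} σ^i(c₁)^{f_{j1}(i)} · ∏_{i<N} σ^i(c₂)^{f_{j2}(i)} = 1` (`j = 1, 2`) with `F₁₁F₂₂ − F₁₂F₂₁ = (X−1)^d·u + 2·g`, `u(1)` odd, `d + 2 ≤ 2^m` ⟹
  **`rank₂ Cl(K_l) ≤ d ∀ l`, `μ₂(κ) = 0`, `λ₂(κ) ≤ d`.**

ROW RECIPE (successor / kit seat; field `−1727`): `K_2 = ℚ(β, ζ₁₆)⁺` (degree `12`), `σ : ζ₁₆+ζ₁₆⁻¹ ↦ …` a generator; two degree-one primes `𝔠₁, 𝔠₂` of `K_2` above rational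
primes `q₁, q₂ ≡ ±1 (mod 16)` whose norms to `K` are `(π₁), (π₂)` with `(π₁, π₂)` realising an INVERTIBLE `2 × 2` matrix of dyadic symbols (e.g. `π₁ ≡ ±3 (mod 𝔭₁³)`,
`π₂ ≡ ±3 (mod 𝔭₂³)`, `π₁π₂ ≡ ±3 (mod 𝔭₁³)` or `(mod 𝔭₂³)`); the `ℤ[G₂]`-relation lattice of `([𝔠₁], [𝔠₂])` in `Cl(K_2)` (PARI `bnfisprincipal`); two rows whose coefficient
determinant has odd part of order `d ≤ 2` at `X = 1`; principal generators of the two products.  CONDITIONAL on displayed data only (no PRINT fact); nothing is asserted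
about any curve; nothing is closed; BSD is not proved.

References: [Washington1997] §13.3 Lemmas 13.15, 13.18, Prop. 13.22–13.23; [Lang1990] Ch. 5 §3, Ch. 13 §4 Lemma 4.1; [Gras2003] IV.4; [Fukuda1994] Thm. 1;
[Omeara1963] §63B (63:10); [NeukirchANT1999] Ch. I §8 (8.2), Ch. II §8 (8.1)–(8.3), Ch. III (2.12); tree: this seat's Literature files `IwasawaTheory/FukudaRelationMatrixAlgebra`
(p835621), `IwasawaTheory/ClassGroupPRankLeOfRelationMatrix` (p835694), `IwasawaTheory/ClassGroupPRankLeOfRelationMatrixTwo` (p835733); att-p3 g53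
`…CubicSplitStratumRelationDoor` (template).
-/

set_option linter.dupNamespace false
set_option autoImplicit false

noncomputable section

open scoped Classical NumberField nonZeroDivisors

namespace Summit.BirchSwinnertonDyer.BirchSwinnertonDyer.Theorems.AlignedTransportAtTwoCubicSplitStratumRelationMatrixDoor

open NumberField IsDedekindDomain Polynomial WeierstrassCurve IntermediateField CongruenceSubgroup Finset
  Literature.NumberTheory.IwasawaTheory Literature.NumberTheory.GaloisRepresentations
  Literature.NumberTheory.GaloisRepresentations.Herbrand Literature.NumberTheory.GaloisRepresentations.MinkowskiUnit
  Literature.NumberTheory.GaloisRepresentations.CyclicNormIndex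
  Literature.NumberTheory.EllipticCurves Literature.NumberTheory.EllipticCurves.Greenberg1999
  Literature.NumberTheory.EllipticCurves.ModularForms
  Literature.NumberTheory.EllipticCurves.Rank1Residual
  Literature.NumberTheory.EllipticCurves.Module
  Literature.NumberTheory.NumberFields Literature.NumberTheory.NumberFields.AmbiguousClass
  Summit.BirchSwinnertonDyer.Rank1Residual
  Summit.BirchSwinnertonDyer.Rank1Residual.X1.MuLambda
  Summit.BirchSwinnertonDyer.Rank1Residual.X5
  Summit.BirchSwinnertonDyer.Rank1Residual.F1Sign2
  Summit.BirchSwinnertonDyer.BirchSwinnertonDyer.Theorems.Rank1ResidualX1Defs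
  Summit.BirchSwinnertonDyer.BirchSwinnertonDyer.Theses.AlignedTransportAtTwo
  Summit.BirchSwinnertonDyer.BirchSwinnertonDyer.Theorems.AlignedTransportAtTwoKilfordStratumShared
  Summit.BirchSwinnertonDyer.BirchSwinnertonDyer.Theorems.AlignedTransportAtTwoCubicCarrierRoad
  Summit.BirchSwinnertonDyer.BirchSwinnertonDyer.Theorems.AlignedTransportAtTwoCubicKilfordPrimes
  Summit.BirchSwinnertonDyer.BirchSwinnertonDyer.Theorems.AlignedTransportAtTwoCubicDepthDoorGenusCert
  Summit.BirchSwinnertonDyer.BirchSwinnertonDyer.Theorems.AlignedTransportAtTwoCubicPrimesOfEmbeddings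
  Summit.BirchSwinnertonDyer.BirchSwinnertonDyer.Theorems.AlignedTransportAtTwoCubicLayerOneDoors
  Summit.BirchSwinnertonDyer.BirchSwinnertonDyer.Theorems.AlignedTransportAtTwoFineRoad.RealKummerLinesPadicLetterOnPointsPrimes

variable (W : WeierstrassCurve ℚ) [W.IsElliptic]

set_option synthInstance.maxHeartbeats 400000 in
set_option maxHeartbeats 1600000 in
/-- **THE TWO-GENERATOR RELATION DOOR for the cubic field `ℚ(β)` of a curve with no rational `2`-torsion.**  `W/ℚ`, no rational `2`-torsion abscissa, `Δ_W < 0`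
(unit rank one), `β ∈ ℚ̄` a root of the `2`-division cubic, `K = ℚ(β)` (at most three primes above `2`); displayed: `h_K` odd, `2 ∤ d_K`; a unit `ε` with `±ε`
non-squares; three ideals `𝔭_a, 𝔭_b, 𝔭_c` of norm `2` with `ε ≡ ±1 (mod 𝔭_j³)` (so every unit is `≡ ±1 (mod 𝔭_j³)`); `κ` a cyclotomic `ℤ₂`-extension of `K`, a layer
`m ≥ 1` with any compatible algebra structure `K_1 → K_m`; two classes `c₁, c₂ ∈ Cl(K_m)` with the GENUS CERTIFICATES `(𝔄_a, k_a, π_a)` for `c₁` at `𝔭_a`, `(𝔄_b, k_b, π_b)`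
for `c₂` at `𝔭_b`, `(𝔄_c, k_c, π_c)` for `c₁c₂` at `𝔭_c` (`N_{K_m/K_1}(c) = [𝔄]`, `N_{K_1/K}(𝔄)^k = (π)`, `π ≡ ±3 (mod 𝔭³)`); `σ` a generator of `Gal(K_m/K)`; and a
**`2 × 2` RELATION MATRIX** `∏_{i<N} σ^i(c₁)^{f_{j1}(i)} · ∏_{i<N} σ^i(c₂)^{f_{j2}(i)} = 1` (`j = 1, 2`) whose coefficient polynomials have determinant
`F₁₁F₂₂ − F₁₂F₂₁ = (X−1)^d·u + 2·g`, `u(1)` odd, `d + 2 ≤ 2^m`.  THEN `rank₂ Cl(K_l) ≤ d` for every `l`, `μ₂(κ) = 0` and `λ₂(κ) ≤ d`.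
[cite: Washington1997, §13.3 Lemmas 13.15, 13.18, Prop. 13.22–13.23] [cite: Lang1990, Ch. 5 §3 and Ch. 13 §4, Lemma 4.1 (PDF pp. 203–204)] [cite: Gras2003, IV.4]
[cite: Omeara1963, §63B (63:10)] [cite: Fukuda1994, Thm. 1, p. 264] [cite: NeukirchANT1999, Ch. I §8 (8.2), Ch. II §8 (8.1)–(8.3)] -/
theorem classicalMuVanishes_adjoin_of_relation_matrix_of_three_genusCerts
    (ht : ∀ x : ℚ, ¬ HasRationalTwoTorsionX W x) (hΔ : W.Δ < 0)
    {β : AlgebraicClosure ℚ} (hβ : aeval β W.twoTorsionPolynomial.toPoly = 0)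
    (hh : haveI : FiniteDimensional ℚ ↥(IntermediateField.adjoin ℚ ({β} : Set (AlgebraicClosure ℚ))) :=
        IntermediateField.adjoin.finiteDimensional ((AlgebraicClosure.isAlgebraic ℚ).isAlgebraic β).isIntegral
      haveI : NumberField ↥(IntermediateField.adjoin ℚ ({β} : Set (AlgebraicClosure ℚ))) := NumberField.mk
      ¬ 2 ∣ classNumber ↥(IntermediateField.adjoin ℚ ({β} : Set (AlgebraicClosure ℚ))))
    (hd : haveI : FiniteDimensional ℚ ↥(IntermediateField.adjoin ℚ ({β} : Set (AlgebraicClosure ℚ))) :=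
        IntermediateField.adjoin.finiteDimensional ((AlgebraicClosure.isAlgebraic ℚ).isAlgebraic β).isIntegral
      haveI : NumberField ↥(IntermediateField.adjoin ℚ ({β} : Set (AlgebraicClosure ℚ))) := NumberField.mk
      ¬ (2 : ℤ) ∣ NumberField.discr ↥(IntermediateField.adjoin ℚ ({β} : Set (AlgebraicClosure ℚ))))
    {ε : (𝓞 ↥(IntermediateField.adjoin ℚ ({β} : Set (AlgebraicClosure ℚ))))ˣ}
    (hnsq : ∀ z : (𝓞 ↥(IntermediateField.adjoin ℚ ({β} : Set (AlgebraicClosure ℚ))))ˣ, ε ≠ z ^ 2 ∧ ε ≠ -z ^ 2)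
    (𝔭a 𝔭b 𝔭c : Ideal (𝓞 ↥(IntermediateField.adjoin ℚ ({β} : Set (AlgebraicClosure ℚ)))))
    (hNa : haveI : FiniteDimensional ℚ ↥(IntermediateField.adjoin ℚ ({β} : Set (AlgebraicClosure ℚ))) :=
        IntermediateField.adjoin.finiteDimensional ((AlgebraicClosure.isAlgebraic ℚ).isAlgebraic β).isIntegral
      haveI : NumberField ↥(IntermediateField.adjoin ℚ ({β} : Set (AlgebraicClosure ℚ))) := NumberField.mk
      Ideal.absNorm 𝔭a = 2)
    (hNb : haveI : FiniteDimensional ℚ ↥(IntermediateField.adjoin ℚ ({β} : Set (AlgebraicClosure ℚ))) :=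
        IntermediateField.adjoin.finiteDimensional ((AlgebraicClosure.isAlgebraic ℚ).isAlgebraic β).isIntegral
      haveI : NumberField ↥(IntermediateField.adjoin ℚ ({β} : Set (AlgebraicClosure ℚ))) := NumberField.mk
      Ideal.absNorm 𝔭b = 2)
    (hNc : haveI : FiniteDimensional ℚ ↥(IntermediateField.adjoin ℚ ({β} : Set (AlgebraicClosure ℚ))) :=
        IntermediateField.adjoin.finiteDimensional ((AlgebraicClosure.isAlgebraic ℚ).isAlgebraic β).isIntegral
      haveI : NumberField ↥(IntermediateField.adjoin ℚ ({β} : Set (AlgebraicClosure ℚ))) := NumberField.mk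
      Ideal.absNorm 𝔭c = 2)
    (hεa : (ε : 𝓞 ↥(IntermediateField.adjoin ℚ ({β} : Set (AlgebraicClosure ℚ)))) - 1 ∈ 𝔭a ^ 3 ∨
      (ε : 𝓞 ↥(IntermediateField.adjoin ℚ ({β} : Set (AlgebraicClosure ℚ)))) + 1 ∈ 𝔭a ^ 3)
    (hεb : (ε : 𝓞 ↥(IntermediateField.adjoin ℚ ({β} : Set (AlgebraicClosure ℚ)))) - 1 ∈ 𝔭b ^ 3 ∨
      (ε : 𝓞 ↥(IntermediateField.adjoin ℚ ({β} : Set (AlgebraicClosure ℚ)))) + 1 ∈ 𝔭b ^ 3)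
    (hεc : (ε : 𝓞 ↥(IntermediateField.adjoin ℚ ({β} : Set (AlgebraicClosure ℚ)))) - 1 ∈ 𝔭c ^ 3 ∨
      (ε : 𝓞 ↥(IntermediateField.adjoin ℚ ({β} : Set (AlgebraicClosure ℚ)))) + 1 ∈ 𝔭c ^ 3)
    (κP : ZpExtension ↥(IntermediateField.adjoin ℚ ({β} : Set (AlgebraicClosure ℚ))) 2) (hκP : κP.IsCyclotomic) {m : ℕ} (hm : 1 ≤ m)
    [NumberField (κP.layer 1)] [NumberField (κP.layer m)] [Algebra (κP.layer 1) (κP.layer m)]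
    [IsScalarTower ↥(IntermediateField.adjoin ℚ ({β} : Set (AlgebraicClosure ℚ))) (κP.layer 1) (κP.layer m)]
    {πa πb πc : 𝓞 ↥(IntermediateField.adjoin ℚ ({β} : Set (AlgebraicClosure ℚ)))}
    (hπa : πa - 3 ∈ 𝔭a ^ 3 ∨ πa + 3 ∈ 𝔭a ^ 3) (hπb : πb - 3 ∈ 𝔭b ^ 3 ∨ πb + 3 ∈ 𝔭b ^ 3) (hπc : πc - 3 ∈ 𝔭c ^ 3 ∨ πc + 3 ∈ 𝔭c ^ 3)
    {Aa Ab Ac : Ideal (𝓞 (κP.layer 1))} (hAa0 : Aa ≠ ⊥) (hAb0 : Ab ≠ ⊥) (hAc0 : Ac ≠ ⊥) {ka kb kc : ℕ}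
    (hAa : haveI : FiniteDimensional ℚ ↥(IntermediateField.adjoin ℚ ({β} : Set (AlgebraicClosure ℚ))) :=
        IntermediateField.adjoin.finiteDimensional ((AlgebraicClosure.isAlgebraic ℚ).isAlgebraic β).isIntegral
      haveI : NumberField ↥(IntermediateField.adjoin ℚ ({β} : Set (AlgebraicClosure ℚ))) := NumberField.mk
      Ideal.relNorm (𝓞 ↥(IntermediateField.adjoin ℚ ({β} : Set (AlgebraicClosure ℚ)))) Aa ^ ka = Ideal.span {πa})
    (hAb : haveI : FiniteDimensional ℚ ↥(IntermediateField.adjoin ℚ ({β} : Set (AlgebraicClosure ℚ))) :=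
        IntermediateField.adjoin.finiteDimensional ((AlgebraicClosure.isAlgebraic ℚ).isAlgebraic β).isIntegral
      haveI : NumberField ↥(IntermediateField.adjoin ℚ ({β} : Set (AlgebraicClosure ℚ))) := NumberField.mk
      Ideal.relNorm (𝓞 ↥(IntermediateField.adjoin ℚ ({β} : Set (AlgebraicClosure ℚ)))) Ab ^ kb = Ideal.span {πb})
    (hAc : haveI : FiniteDimensional ℚ ↥(IntermediateField.adjoin ℚ ({β} : Set (AlgebraicClosure ℚ))) :=
        IntermediateField.adjoin.finiteDimensional ((AlgebraicClosure.isAlgebraic ℚ).isAlgebraic β).isIntegral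
      haveI : NumberField ↥(IntermediateField.adjoin ℚ ({β} : Set (AlgebraicClosure ℚ))) := NumberField.mk
      Ideal.relNorm (𝓞 ↥(IntermediateField.adjoin ℚ ({β} : Set (AlgebraicClosure ℚ)))) Ac ^ kc = Ideal.span {πc})
    (σ : (κP.layer m) ≃ₐ[↥(IntermediateField.adjoin ℚ ({β} : Set (AlgebraicClosure ℚ)))] (κP.layer m))
    (hσ : ∀ τ : (κP.layer m) ≃ₐ[↥(IntermediateField.adjoin ℚ ({β} : Set (AlgebraicClosure ℚ)))] (κP.layer m), τ ∈ Subgroup.zpowers σ)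
    {c₁ c₂ : ClassGroup (𝓞 (κP.layer m))}
    (hcAa : classGroupNorm (κP.layer 1) (κP.layer m) c₁ = ClassGroup.mk0 ⟨Aa, mem_nonZeroDivisors_of_ne_zero hAa0⟩)
    (hcAb : classGroupNorm (κP.layer 1) (κP.layer m) c₂ = ClassGroup.mk0 ⟨Ab, mem_nonZeroDivisors_of_ne_zero hAb0⟩)
    (hcAc : classGroupNorm (κP.layer 1) (κP.layer m) (c₁ * c₂) = ClassGroup.mk0 ⟨Ac, mem_nonZeroDivisors_of_ne_zero hAc0⟩)
    {N d : ℕ} (hd2 : d + 2 ≤ 2 ^ m) {f₁₁ f₁₂ f₂₁ f₂₂ : ℕ → ℤ} {u g : ℤ[X]} (hu : ¬ (2 : ℤ) ∣ u.eval 1)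
    (hF : (∑ i ∈ range N, C (f₁₁ i) * X ^ i : ℤ[X]) * (∑ i ∈ range N, C (f₂₂ i) * X ^ i) -
        (∑ i ∈ range N, C (f₁₂ i) * X ^ i) * (∑ i ∈ range N, C (f₂₁ i) * X ^ i) = (X - 1) ^ d * u + C (2 : ℤ) * g)
    (hrel₁ : (∏ i ∈ range N, (ClassGroup.mulEquiv (intAut (σ ^ i)) c₁) ^ (f₁₁ i)) *
        ∏ i ∈ range N, (ClassGroup.mulEquiv (intAut (σ ^ i)) c₂) ^ (f₁₂ i) = 1)
    (hrel₂ : (∏ i ∈ range N, (ClassGroup.mulEquiv (intAut (σ ^ i)) c₁) ^ (f₂₁ i)) *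
        ∏ i ∈ range N, (ClassGroup.mulEquiv (intAut (σ ^ i)) c₂) ^ (f₂₂ i) = 1) :
    (∀ l, classGroupPRank κP l ≤ d) ∧ ClassicalMuVanishes κP ∧ classicalLambda κP ≤ d := by
  have hirr := AlignedTransportAtTwoSeed.irr_two_of_forall_not_hasRationalTwoTorsionX W ht
  have hβint : IsIntegral ℚ β := ((AlgebraicClosure.isAlgebraic ℚ).isAlgebraic β).isIntegral
  haveI : FiniteDimensional ℚ ↥(IntermediateField.adjoin ℚ ({β} : Set (AlgebraicClosure ℚ))) := IntermediateField.adjoin.finiteDimensional hβint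
  haveI : NumberField ↥(IntermediateField.adjoin ℚ ({β} : Set (AlgebraicClosure ℚ))) := NumberField.mk
  haveI : Fact (Nat.Prime 2) := ⟨Nat.prime_two⟩
  have h3 : Module.finrank ℚ ↥(IntermediateField.adjoin ℚ ({β} : Set (AlgebraicClosure ℚ))) = 3 :=
    AddKatoTwo.finrank_adjoin_root_twoTorsionPolynomial_eq_three W hirr hβ
  have hodd3 : ¬ 2 ∣ Module.finrank ℚ ↥(IntermediateField.adjoin ℚ ({β} : Set (AlgebraicClosure ℚ))) := by rw [h3]; decide
  have hoddK : Odd (Module.finrank ℚ ↥(IntermediateField.adjoin ℚ ({β} : Set (AlgebraicClosure ℚ)))) :=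
    Nat.odd_iff.mpr (Nat.two_dvd_ne_zero.mp hodd3)
  -- unit rank `1` (`Δ_W < 0`: one real place)
  have hrank : Units.rank ↥(IntermediateField.adjoin ℚ ({β} : Set (AlgebraicClosure ℚ))) = 1 :=
    units_rank_eq_one_of_nrRealPlaces_eq_one _ h3 (nrRealPlaces_adjoin_root_twoTorsionPolynomial_eq_one W hΔ hirr hβ)
  -- at most three primes above `2` in the cubic field
  have h3card : {v : HeightOneSpectrum (𝓞 ↥(IntermediateField.adjoin ℚ ({β} : Set (AlgebraicClosure ℚ)))) |
      ((2 : ℕ) : 𝓞 ↥(IntermediateField.adjoin ℚ ({β} : Set (AlgebraicClosure ℚ)))) ∈ v.asIdeal}.ncard ≤ 3 := by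
    have hfin := finite_setOf_two_mem (F := ↥(IntermediateField.adjoin ℚ ({β} : Set (AlgebraicClosure ℚ))))
    rw [Set.ncard_eq_toFinset_card _ hfin, ← h3]
    exact card_le_finrank_of_forall_natCast_mem 2 hfin.toFinset fun v hv ↦ by
      simpa using (Set.Finite.mem_toFinset hfin).mp hv
  -- the three dyadic primes of degree one; all units `≡ ±1 (mod 𝔭_j³)`
  obtain ⟨h𝔭a, hPa0, h2Pa, hcarda⟩ := isPrime_and_mem_of_absNorm_eq_two 𝔭a hNa
  haveI := h𝔭a
  haveI : 𝔭a.IsMaximal := h𝔭a.isMaximal hPa0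
  have hresa := forall_mem_or_sub_one_mem_of_card_quotient_eq_two 𝔭a hcarda
  have hunitsa := forall_units_sub_one_mem_or_add_one_mem_of_rank_eq_one hoddK hrank 𝔭a hPa0 hresa h2Pa
    (two_not_mem_sq_of_not_dvd_discr hd 𝔭a h2Pa) hεa hnsq
  obtain ⟨h𝔭b, hPb0, h2Pb, hcardb⟩ := isPrime_and_mem_of_absNorm_eq_two 𝔭b hNb
  haveI := h𝔭b
  haveI : 𝔭b.IsMaximal := h𝔭b.isMaximal hPb0
  have hresb := forall_mem_or_sub_one_mem_of_card_quotient_eq_two 𝔭b hcardb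
  have hunitsb := forall_units_sub_one_mem_or_add_one_mem_of_rank_eq_one hoddK hrank 𝔭b hPb0 hresb h2Pb
    (two_not_mem_sq_of_not_dvd_discr hd 𝔭b h2Pb) hεb hnsq
  obtain ⟨h𝔭c, hPc0, h2Pc, hcardc⟩ := isPrime_and_mem_of_absNorm_eq_two 𝔭c hNc
  haveI := h𝔭c
  haveI : 𝔭c.IsMaximal := h𝔭c.isMaximal hPc0
  have hresc := forall_mem_or_sub_one_mem_of_card_quotient_eq_two 𝔭c hcardc
  have hunitsc := forall_units_sub_one_mem_or_add_one_mem_of_rank_eq_one hoddK hrank 𝔭c hPc0 hresc h2Pc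
    (two_not_mem_sq_of_not_dvd_discr hd 𝔭c h2Pc) hεc hnsq
  exact classicalMuVanishes_two_of_relation_matrix_of_three_genusCerts hodd3 hd κP hκP h3card hh hm 𝔭a hresa h2Pa hunitsa hπa hAa0 hAa
    𝔭b hresb h2Pb hunitsb hπb hAb0 hAb 𝔭c hresc h2Pc hunitsc hπc hAc0 hAc σ hσ hcAa hcAb hcAc hd2 hu hF hrel₁ hrel₂

end Summit.BirchSwinnertonDyer.BirchSwinnertonDyer.Theorems.AlignedTransportAtTwoCubicSplitStratumRelationMatrixDoor

end
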